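import Mathlib
import Literature.AlgebraicGeometry.Resolution.CobordantGame
import Summits.ResolutionOfSingularities.ResolutionOfSingularities.Theorems.WeightedInvariantLocalWeightedDropSeparablePureCleaning

/-!
# `WeightedInvariant.LocalWeightedDrop`, line `hasse-ridge-face-selection`: UNIQUENESS of the Artin–Schreier normal form of a pure
# separable char-`2` double point — the REDUCED POLAR PART is an invariant of the position

Crux item stmt-ResolutionOfSingularities-8899 `LocalWeightedDrop` (route `ResolutionOfSingularities/WeightedInvariant`), serving the
door `HypersurfaceCentreConstruction` stmt-ResolutionOfSingularities-19897.  [OURS · L1 W4.3, chain w43, stub worker 5 (seat res-D-pv-056):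
brick U0 (second half) of the S2sP work order for the registered stub S2sP `stub_charTwoSeparablePureWon` of skeleton v28; companion of
`…SeparablePureCleaning` (p498990, existence); NOT a statement of any manuscript.]

A pure separable position `y² + x^α y + A₀` is the class of `A₀` modulo `N_α = {x^α ψ + ψ²}` (re-centrings `y ↦ y + ψ`).  The existence
half produced a CLEAN representative (no square monomial `x^{2e}` with `¬ (α ≤ e)`).  Here: the clean representative is UNIQUE MODULO
`x^{2α}` — so its part off the multiples of `x^{2α}` (the «reduced polar part», in Artin–Schreier language the polar part of
`h = A₀ / x^{2α}` modulo `ψ̃² + ψ̃`) is an INVARIANT of the position, on which an invariant-based S2sP engine (Newton polygon / height of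
the reduced part, Hauser–Wagner style) can be defined.

* `coeff_eq_zero_of_asClean_self` — if `x^α ψ + ψ²` itself is clean on the region then `ψ` has NO monomial there (`ψ ∈ x^α · k⟦x⟧`):
  at a region exponent `e` of `ψ` with MINIMAL deficient coordinate, the feed `[x^{2e−α}]ψ` vanishes (its deficient coordinate is smaller),
  so `[x^{2e}](x^αψ + ψ²) = ([x^e]ψ)² ≠ 0`;
* `exists_eq_monomial_mul_of_coeff_eq_zero` — such a `ψ` is `x^α · χ`, hence `x^α ψ + ψ² = x^{2α}(χ + χ²)` (`sq_add_monomial_mul_eq`);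
* `coeff_eq_of_asClean` — TWO CLEAN REPRESENTATIVES OF ONE CLASS AGREE on every monomial `x^d` with `¬ (2α ≤ d)`;
* `coeff_eq_of_asClean_pure` — the game form on `k⟦x₀,x₁⟧`, `x^α = x₀^a x₁^b`: agreement on all `x₀^{m₀} x₁^{m₁}` with `m₀ < 2a ∨ m₁ < 2b`.
AI-written; gate-accepted means sorry-free with standard axioms, not refereed.
-/

set_option linter.dupNamespace false -- mandated namespace of this single-conjunct summit

namespace Summit.ResolutionOfSingularities.ResolutionOfSingularities.Theorems

open Literature.AlgebraicGeometry.Resolution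

namespace SepPureCleaning

open MvPowerSeries InsepCleaning

variable {k : Type} [Field k] {σ : Type}

/-- RIGIDITY OF THE CLASS GROUP ON THE REGION (characteristic `2`): if `x^α ψ + ψ²` has no square monomial `x^{2e}` with `¬ (α ≤ e)`,
then `ψ` has no monomial `x^e` with `¬ (α ≤ e)`.  (Minimal-deficient-coordinate argument: the feed exponent `2e − α` of a region exponent
`e` deficient at `i` is again deficient at `i`, with `(2e − α)_i < e_i`.) -/
theorem coeff_eq_zero_of_asClean_self [CharP k 2] {α : σ →₀ ℕ} {ψ : MvPowerSeries σ k}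
    (hclean : ∀ e : σ →₀ ℕ, ¬ α ≤ e → coeff (2 • e) (monomial α 1 * ψ + ψ ^ 2) = 0) :
    ∀ e : σ →₀ ℕ, ¬ α ≤ e → coeff e ψ = 0 := by
  classical
  by_contra hcon
  push Not at hcon
  have hS : ∃ n : ℕ, ∃ (e : σ →₀ ℕ) (i : σ), e i < α i ∧ e i = n ∧ coeff e ψ ≠ 0 := by
    obtain ⟨e, he, hne⟩ := hcon
    obtain ⟨i, hi⟩ : ∃ i, e i < α i := by
      by_contra h
      push Not at h
      exact he (Finsupp.le_def.mpr h)
    exact ⟨e i, e, i, hi, rfl, hne⟩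
  obtain ⟨e, i, hi, hei, hne⟩ := Nat.find_spec hS
  have hmin : ∀ (e' : σ →₀ ℕ) (j : σ), e' j < α j → e' j < Nat.find hS → coeff e' ψ = 0 := fun e' j hj hlt => by
    by_contra hne'
    exact Nat.find_min hS hlt ⟨e', j, hj, rfl, hne'⟩
  have he : ¬ α ≤ e := fun h => absurd (Finsupp.le_def.mp h i) (not_le.mpr hi)
  have h := hclean e he
  rw [map_add, coeff_two_nsmul_sq, coeff_monomial_mul] at h
  split_ifs at h with h2
  · have h2i : α i ≤ 2 * e i := by
      simpa only [Finsupp.smul_apply, smul_eq_mul] using Finsupp.le_def.mp h2 i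
    have hz : coeff (2 • e - α) ψ = 0 := by
      refine hmin (2 • e - α) i ?_ ?_
      · simp only [Finsupp.tsub_apply, Finsupp.smul_apply, smul_eq_mul]
        omega
      · rw [← hei]
        simp only [Finsupp.tsub_apply, Finsupp.smul_apply, smul_eq_mul]
        omega
    rw [hz, mul_zero, zero_add, sq_eq_zero_iff] at h
    exact hne h
  · rw [zero_add, sq_eq_zero_iff] at h
    exact hne h

/-- A series with no monomial `x^e`, `¬ (α ≤ e)`, is a multiple of `x^α`. -/
theorem exists_eq_monomial_mul_of_coeff_eq_zero {α : σ →₀ ℕ} {ψ : MvPowerSeries σ k}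
    (h : ∀ e : σ →₀ ℕ, ¬ α ≤ e → coeff e ψ = 0) :
    ∃ χ : MvPowerSeries σ k, ψ = monomial α 1 * χ := by
  classical
  refine ⟨fun e => coeff (e + α) ψ, ?_⟩
  ext d
  rw [coeff_monomial_mul]
  split_ifs with hd
  · rw [one_mul, coeff_apply (fun e : σ →₀ ℕ => coeff (e + α) ψ), tsub_add_cancel_of_le hd]
  · exact h d hd

/-- `x^α (x^α χ) + (x^α χ)² = x^{2α} (χ + χ²)`. -/
theorem sq_add_monomial_mul_eq (α : σ →₀ ℕ) (χ : MvPowerSeries σ k) :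
    monomial α (1 : k) * (monomial α 1 * χ) + (monomial α 1 * χ) ^ 2 = monomial (2 • α) 1 * (χ + χ ^ 2) := by
  have h2 : (monomial (2 • α) (1 : k) : MvPowerSeries σ k) = monomial α 1 * monomial α 1 := by
    rw [monomial_mul_monomial, one_mul, two_nsmul]
  rw [h2]
  ring

/-- THE DIFFERENCE OF TWO CLEAN REPRESENTATIVES IS A MULTIPLE OF `x^{2α}`: if `R' = R + x^α ψ + ψ²` and both `R`, `R'` are clean on the
region, then `ψ ∈ x^α·k⟦x⟧` and `R' = R + x^{2α}(χ + χ²)`. -/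
theorem exists_eq_add_monomial_two_nsmul_mul_of_asClean [CharP k 2] {α : σ →₀ ℕ} {R R' ψ : MvPowerSeries σ k}
    (hRR' : R' = R + monomial α 1 * ψ + ψ ^ 2)
    (hR : ∀ e : σ →₀ ℕ, ¬ α ≤ e → coeff (2 • e) R = 0) (hR' : ∀ e : σ →₀ ℕ, ¬ α ≤ e → coeff (2 • e) R' = 0) :
    ∃ χ : MvPowerSeries σ k, ψ = monomial α 1 * χ ∧ R' = R + monomial (2 • α) 1 * (χ + χ ^ 2) := by
  have hD : monomial α 1 * ψ + ψ ^ 2 = R' - R := by rw [hRR']; ring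
  have hclean : ∀ e : σ →₀ ℕ, ¬ α ≤ e → coeff (2 • e) (monomial α 1 * ψ + ψ ^ 2) = 0 := fun e he => by
    rw [hD, map_sub, hR e he, hR' e he, sub_zero]
  obtain ⟨χ, rfl⟩ := exists_eq_monomial_mul_of_coeff_eq_zero (coeff_eq_zero_of_asClean_self hclean)
  refine ⟨χ, rfl, ?_⟩
  rw [hRR', add_assoc, sq_add_monomial_mul_eq]

/-- UNIQUENESS OF THE ARTIN–SCHREIER NORMAL FORM MODULO `x^{2α}` (characteristic `2`): two clean representatives `R`, `R' = R + x^αψ + ψ²`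
of one position class have THE SAME COEFFICIENT at every `x^d` with `¬ (2α ≤ d)`.  So the reduced polar part of a clean representative is an
invariant of the class. -/
theorem coeff_eq_of_asClean [CharP k 2] {α : σ →₀ ℕ} {R R' ψ : MvPowerSeries σ k}
    (hRR' : R' = R + monomial α 1 * ψ + ψ ^ 2)
    (hR : ∀ e : σ →₀ ℕ, ¬ α ≤ e → coeff (2 • e) R = 0) (hR' : ∀ e : σ →₀ ℕ, ¬ α ≤ e → coeff (2 • e) R' = 0)
    {d : σ →₀ ℕ} (hd : ¬ 2 • α ≤ d) : coeff d R' = coeff d R := by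
  classical
  obtain ⟨χ, -, h⟩ := exists_eq_add_monomial_two_nsmul_mul_of_asClean hRR' hR hR'
  rw [h, map_add, coeff_monomial_mul, if_neg hd, add_zero]

/-! ### The game form on `k⟦x₀,x₁⟧` -/

/-- UNIQUENESS FOR PURE SEPARABLE POSITIONS `y² + x₀^a x₁^b y + A₀`: if `A₀` and `A₀' = A₀ + x₀^a x₁^b ψ + ψ²` are both clean (no
`x₀^{2e₀}x₁^{2e₁}` with `e₀ < a ∨ e₁ < b`), then they agree on every monomial `x₀^{m₀} x₁^{m₁}` with `m₀ < 2a ∨ m₁ < 2b`, and the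
re-centring `ψ` is a multiple of `x₀^a x₁^b`. -/
theorem coeff_eq_of_asClean_pure [CharP k 2] (a b : ℕ) {A₀ A₀' ψ : MvPowerSeries (Fin 2) k}
    (hAA' : A₀' = A₀ + X 0 ^ a * X 1 ^ b * ψ + ψ ^ 2)
    (hA : ∀ e : Fin 2 →₀ ℕ, (e 0 < a ∨ e 1 < b) → coeff (2 • e) A₀ = 0)
    (hA' : ∀ e : Fin 2 →₀ ℕ, (e 0 < a ∨ e 1 < b) → coeff (2 • e) A₀' = 0) :
    (∀ m : Fin 2 →₀ ℕ, (m 0 < 2 * a ∨ m 1 < 2 * b) → coeff m A₀' = coeff m A₀) ∧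
      ∃ χ : MvPowerSeries (Fin 2) k, ψ = X 0 ^ a * X 1 ^ b * χ := by
  classical
  rw [TerminalDoublePoint.X_pow_mul_X_pow_eq] at hAA' ⊢
  set α : Fin 2 →₀ ℕ := Finsupp.single 0 a + Finsupp.single 1 b with hα
  have hα0 : α 0 = a := by simp [hα]
  have hα1 : α 1 = b := by simp [hα]
  have hreg : ∀ e : Fin 2 →₀ ℕ, ¬ α ≤ e ↔ (e 0 < a ∨ e 1 < b) := fun e => by
    rw [Finsupp.le_def, Fin.forall_fin_two, hα0, hα1]
    omega
  have hR : ∀ e : Fin 2 →₀ ℕ, ¬ α ≤ e → coeff (2 • e) A₀ = 0 := fun e he => hA e ((hreg e).mp he)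
  have hR' : ∀ e : Fin 2 →₀ ℕ, ¬ α ≤ e → coeff (2 • e) A₀' = 0 := fun e he => hA' e ((hreg e).mp he)
  refine ⟨fun m hm => coeff_eq_of_asClean hAA' hR hR' fun h => ?_, ?_⟩
  · have h0 := Finsupp.le_def.mp h 0
    have h1 := Finsupp.le_def.mp h 1
    simp only [Finsupp.smul_apply, smul_eq_mul, hα0, hα1] at h0 h1
    omega
  · obtain ⟨χ, hχ, -⟩ := exists_eq_add_monomial_two_nsmul_mul_of_asClean hAA' hR hR'
    exact ⟨χ, hχ⟩

end SepPureCleaning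

end Summit.ResolutionOfSingularities.ResolutionOfSingularities.Theorems
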